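import Summits.Ventures.HSemireg.WedgeHankelRecurrencePeriodNodes

/-!
# Venture HSemireg — THE LEAST PERIOD OF A SUM OF EXPONENTIALS IS THE LCM OF THE ORDERS OF ITS NODES: for distinct nodes `λ_i` and non-zero weights `A_i` (any field),
# **`secSeq A λ = (Σ_i A_i λ_i^j)_j` is `T`-periodic iff `lcm_i ord(λ_i) ∣ T`; a positive period exists iff every node is a root of unity, and then the least period is `lcm_i ord(λ_i)`**

HONEST FRAMING. Part of the Lean index of the computation cell `pub-hsemireg` (seat p10 gen 30, Sunday typer «UNIFORM-IN-n»).
LINEAR ALGEBRA OF HANKEL (catalecticant) MATRICES and of polynomials over a field ONLY: no variety, no cohomology theory, no sheaf, no Ext group and no semiregularity map is constructed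
here; nothing here says that HC / HC_CM / HC_AV holds; no Literature fact is declared or used.  Custodian versions as in `WedgeHankelSiegelIdeal` (1/3).

WHAT IS IN THE TREE.  N89 (`WedgeHankelRecurrencePeriodNodes`): `periodic_secSeq_iff` (`T`-periodic ↔ `∀ i, λ_i^T = 1`).  Mathlib: `orderOf_dvd_iff_pow_eq_one`, `Finset.lcm_dvd_iff`, `Finset.lcm_eq_zero_iff`,
`isOfFinOrder_iff_pow_eq_one`, `IsOfFinOrder.orderOf_pos`.
THIS FILE (namespace `Summit.Ventures.HSemireg.Wedge.HankelOuter` continued; CHAINED on N89; 0 definitions; every statement over an ARBITRARY field, `λ` injective, all `A_i ≠ 0`):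
* §647 **`periodic_secSeq_iff_lcm_orderOf_dvd`** (`T`-periodic ↔ `univ.lcm (orderOf ∘ λ) ∣ T`), `periodic_secSeq_lcm_orderOf` (the lcm is a period), `isOfFinOrder_of_periodic_secSeq` (a positive period
  forces every node to be a root of unity), **`isLeast_setOf_periodic_secSeq`** (all nodes of finite order ⇒ THE LEAST POSITIVE PERIOD IS `lcm_i ord(λ_i)`).
Nothing Ext-side.  New names only.
-/

open Module Polynomial
open scoped Matrix Polynomial

namespace Summit.Ventures.HSemireg.Wedge.HankelOuter

open Summit.Ventures.HSemireg.Wedge Summit.Ventures.HSemireg.Wedge.Hankel Summit.Ventures.HSemireg.Wedge.HankelSecant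

variable (K : Type*) [Field K]

/-! ## §647. The least period of a sum of exponentials -/

/-- **`secSeq A λ` (distinct nodes, non-zero weights) is `T`-periodic iff `lcm_i ord(λ_i) ∣ T`** (`orderOf (λ_i) = 0` for a node of infinite order, and then only `T = 0` qualifies). Any field. -/
theorem periodic_secSeq_iff_lcm_orderOf_dvd {r : ℕ} (A lam : Fin r → K) (hinj : Function.Injective lam) (hA : ∀ i, A i ≠ 0) (T : ℕ) :
    Function.Periodic (secSeq K A lam) T ↔ (Finset.univ.lcm fun i => orderOf (lam i)) ∣ T := by
  rw [periodic_secSeq_iff K A lam hinj hA T, Finset.lcm_dvd_iff]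
  simp only [Finset.mem_univ, forall_const, orderOf_dvd_iff_pow_eq_one]

/-- the lcm of the orders of the nodes is a period of `secSeq A λ`. -/
theorem periodic_secSeq_lcm_orderOf {r : ℕ} (A lam : Fin r → K) (hinj : Function.Injective lam) (hA : ∀ i, A i ≠ 0) :
    Function.Periodic (secSeq K A lam) (Finset.univ.lcm fun i => orderOf (lam i)) :=
  (periodic_secSeq_iff_lcm_orderOf_dvd K A lam hinj hA _).mpr dvd_rfl

/-- **a positive period forces every node to be a root of unity** (distinct nodes, non-zero weights). Any field. -/
theorem isOfFinOrder_of_periodic_secSeq {r : ℕ} (A lam : Fin r → K) (hinj : Function.Injective lam) (hA : ∀ i, A i ≠ 0) {T : ℕ} (hT : 0 < T)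
    (hper : Function.Periodic (secSeq K A lam) T) (i : Fin r) : IsOfFinOrder (lam i) :=
  isOfFinOrder_iff_pow_eq_one.mpr ⟨T, hT, (periodic_secSeq_iff K A lam hinj hA T).mp hper i⟩

/-- **THE LEAST PERIOD OF A SUM OF EXPONENTIALS IS THE LCM OF THE ORDERS OF ITS NODES**: for distinct nodes of finite multiplicative order and non-zero weights, the least positive period of
`secSeq A λ` is `lcm_i ord(λ_i)`. Any field. -/
theorem isLeast_setOf_periodic_secSeq {r : ℕ} (A lam : Fin r → K) (hinj : Function.Injective lam) (hA : ∀ i, A i ≠ 0) (hord : ∀ i, IsOfFinOrder (lam i)) :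
    IsLeast {T : ℕ | 0 < T ∧ Function.Periodic (secSeq K A lam) T} (Finset.univ.lcm fun i => orderOf (lam i)) := by
  refine ⟨⟨Nat.pos_of_ne_zero fun h => ?_, periodic_secSeq_lcm_orderOf K A lam hinj hA⟩,
    fun T hT => Nat.le_of_dvd hT.1 ((periodic_secSeq_iff_lcm_orderOf_dvd K A lam hinj hA T).mp hT.2)⟩
  obtain ⟨i, -, hi⟩ := (Set.mem_image _ _ _).mp (Finset.lcm_eq_zero_iff.mp h)
  exact (hord i).orderOf_pos.ne' hi

end Summit.Ventures.HSemireg.Wedge.HankelOuter
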